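import Summits.ResolutionOfSingularities.ResolutionOfSingularities.Theorems.FrobeniusLadderFInjectiveMacaulayficationDoublePointFedderOdd

/-!
# Fedder's test for double points `z² + z ψ(x, y) + φ(x, y)` in characteristic 2

Support file for crux stmt-ResolutionOfSingularities-15315
(`FrobeniusLadder.FInjectiveMacaulayfication`, line `Sketch`): stub `stub_doublePointFedderTwo`.

Let `k` be a field of characteristic `2` and `ψ, φ ∈ k[X₀, X₁]`. By Fedder's criterion
([Fedder1983], Prop. 1.7) the hypersurface double point `k[X₀, X₁, X₂]_{(X)}/(g)`,
`g = X₂² + X₂ ψ + φ`, is F-injective iff `g^(p-1) = g ∉ M₃ = (X₀², X₁², X₂²)`. We reduce this to a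
condition on the plane data `ψ, φ` alone:

* `stub_doublePointFedderTwo` — `g ∉ (X₀², X₁², X₂²)` iff `ψ ∉ (X₀², X₁²)` or `φ ∉ (X₀², X₁²)`.

Proof. Membership in the monomial ideal `M₃` is decided monomial by monomial: `f ∈ M₃` iff every
monomial of the support of `f` has an exponent `≥ 2` (`DoublePointFedder.mem_span_X_pow_iff`, from
the odd-characteristic sibling file, whose elementary helpers we reuse). The three summands
`X₂²`, `X₂ ψ`, `φ` of `g` have pairwise disjoint supports, separated by the `X₂`-exponent
(`2`, `1`, `0` respectively). Hence for a monomial `m₀ = X₀^a X₁^b` of `ψ` the coefficient of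
`X₂ m₀` in `g` is `coeff_{m₀} ψ` (`coeff_X₂_mul_eq`), and for a monomial `m₀` of `φ` the coefficient
of `m₀` in `g` is `coeff_{m₀} φ` (`coeff_plane_eq`). If `g ∈ M₃`, these monomials of `g` have an
exponent `≥ 2`, which cannot be the `X₂`-exponent; so `ψ ∈ M₂ = (X₀², X₁²)` and `φ ∈ M₂`. The
converse `ψ, φ ∈ M₂ ⟹ g ∈ M₃` is termwise. (No hypothesis on the characteristic is needed for
this equivalence; `CharP k 2` only records the context `g^(p-1) = g`.)

References: [Fedder1983] R. Fedder, F-purity and rational singularity, Trans. AMS 278 (1983),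
Prop. 1.7 (the criterion; the reduction itself is folklore).
-/

-- single-problem summit: the doubled namespace component `ResolutionOfSingularities` is forced
set_option linter.dupNamespace false

namespace Summit.ResolutionOfSingularities.ResolutionOfSingularities.Theorems.FInjectiveMacaulayfication.DoublePointFedderTwo

open MvPolynomial
open Summit.ResolutionOfSingularities.ResolutionOfSingularities.Theorems.FInjectiveMacaulayfication.DoublePointFedder
  (mem_span_X_pow_iff rename_mem_of_mem two_notMem_range_castSucc)

variable {k : Type} [Field k]

/-- A plane monomial `m₀ = X₀^a X₁^b`, viewed in three variables, has `X₂`-exponent `0`.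
[folklore] -/
theorem mapDomain_castSucc_two (m₀ : Fin 2 →₀ ℕ) :
    (Finsupp.mapDomain Fin.castSucc m₀ : Fin 3 →₀ ℕ) 2 = 0 :=
  Finsupp.mapDomain_notin_range _ _ two_notMem_range_castSucc

/-- The monomial `X₂ m₀` (`m₀` a plane monomial) has `X₂`-exponent `1`. [folklore] -/
theorem single_add_mapDomain_two (m₀ : Fin 2 →₀ ℕ) :
    (Finsupp.single (2 : Fin 3) 1 + Finsupp.mapDomain Fin.castSucc m₀ : Fin 3 →₀ ℕ) 2 = 1 := by
  rw [Finsupp.add_apply, Finsupp.single_eq_same, mapDomain_castSucc_two, add_zero]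

/-- The monomial `X₂ m₀` (`m₀ = X₀^a X₁^b`) has the same `X₀, X₁`-exponents as `m₀`. [folklore] -/
theorem single_add_mapDomain_castSucc (m₀ : Fin 2 →₀ ℕ) (j : Fin 2) :
    (Finsupp.single (2 : Fin 3) 1 + Finsupp.mapDomain Fin.castSucc m₀ : Fin 3 →₀ ℕ)
      (Fin.castSucc j) = m₀ j := by
  rw [Finsupp.add_apply, Finsupp.mapDomain_apply (Fin.castSucc_injective 2),
    Finsupp.single_eq_of_ne (show Fin.castSucc j ≠ (2 : Fin 3) from Fin.castSucc_ne_last j),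
    zero_add]

/-- Disjointness of supports, `X₂`-exponent `1`: the coefficient of `X₂ m₀` (`m₀` a plane monomial)
in `g = X₂² + X₂ ψ + φ` is the coefficient of `m₀` in `ψ`. [folklore] -/
theorem coeff_X₂_mul_eq (ψ φ : MvPolynomial (Fin 2) k) (m₀ : Fin 2 →₀ ℕ) :
    coeff (Finsupp.single (2 : Fin 3) 1 + Finsupp.mapDomain Fin.castSucc m₀)
      (X 2 ^ 2 + X 2 * rename Fin.castSucc ψ + rename Fin.castSucc φ : MvPolynomial (Fin 3) k) =
      coeff m₀ ψ := by
  have hne : Finsupp.single (2 : Fin 3) 2 ≠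
      Finsupp.single (2 : Fin 3) 1 + Finsupp.mapDomain Fin.castSucc m₀ := by
    intro h
    have h2 := DFunLike.congr_fun h 2
    rw [Finsupp.single_eq_same, single_add_mapDomain_two] at h2
    omega
  have hmem : (2 : Fin 3) ∈
      (Finsupp.single (2 : Fin 3) 1 + Finsupp.mapDomain Fin.castSucc m₀).support := by
    rw [Finsupp.mem_support_iff, single_add_mapDomain_two]
    exact one_ne_zero
  have hzero : ∀ u : Fin 2 →₀ ℕ, Finsupp.mapDomain Fin.castSucc u =
      Finsupp.single (2 : Fin 3) 1 + Finsupp.mapDomain Fin.castSucc m₀ → φ.coeff u = 0 := by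
    intro u hu
    exfalso
    have h2 := DFunLike.congr_fun hu 2
    rw [mapDomain_castSucc_two, single_add_mapDomain_two] at h2
    omega
  rw [coeff_add, coeff_add, coeff_X_pow, if_neg hne, zero_add, coeff_X_mul', if_pos hmem,
    add_tsub_cancel_left, coeff_rename_mapDomain _ (Fin.castSucc_injective 2),
    coeff_rename_eq_zero _ _ _ hzero, add_zero]

/-- Disjointness of supports, `X₂`-exponent `0`: the coefficient of a plane monomial `m₀` in
`g = X₂² + X₂ ψ + φ` is the coefficient of `m₀` in `φ`. [folklore] -/
theorem coeff_plane_eq (ψ φ : MvPolynomial (Fin 2) k) (m₀ : Fin 2 →₀ ℕ) :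
    coeff (Finsupp.mapDomain Fin.castSucc m₀)
      (X 2 ^ 2 + X 2 * rename Fin.castSucc ψ + rename Fin.castSucc φ : MvPolynomial (Fin 3) k) =
      coeff m₀ φ := by
  have hne : Finsupp.single (2 : Fin 3) 2 ≠ Finsupp.mapDomain Fin.castSucc m₀ := by
    intro h
    have h2 := DFunLike.congr_fun h 2
    rw [Finsupp.single_eq_same, mapDomain_castSucc_two] at h2
    omega
  have hmem : (2 : Fin 3) ∉ (Finsupp.mapDomain Fin.castSucc m₀ : Fin 3 →₀ ℕ).support := by
    rw [Finsupp.mem_support_iff, mapDomain_castSucc_two]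
    exact fun h => h rfl
  rw [coeff_add, coeff_add, coeff_X_pow, if_neg hne, zero_add, coeff_X_mul', if_neg hmem, zero_add,
    coeff_rename_mapDomain _ (Fin.castSucc_injective 2)]

/-- **Fedder's test for a double point `X₂² + X₂ ψ(X₀, X₁) + φ(X₀, X₁)` in characteristic `2`**
reduces to the plane data: `X₂² + X₂ ψ + φ ∉ (X₀², X₁², X₂²)` iff `ψ ∉ (X₀², X₁²)` or
`φ ∉ (X₀², X₁²)`. (Membership in a monomial ideal is decided monomial by monomial, and the three
summands have disjoint supports, separated by the `X₂`-exponent `2`, `1`, `0`.) Stub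
`stub_doublePointFedderTwo` of line `Sketch`; the surrounding criterion is
[cite: Fedder1983, Prop. 1.7], the reduction is [folklore]. -/
theorem stub_doublePointFedderTwo : ∀ (k : Type) [Field k] [CharP k 2] (ψ φ : MvPolynomial (Fin 2) k),
    ((MvPolynomial.X 2 ^ 2 + MvPolynomial.X 2 * MvPolynomial.rename Fin.castSucc ψ +
        MvPolynomial.rename Fin.castSucc φ : MvPolynomial (Fin 3) k) ∉
        Ideal.span (Set.range fun i : Fin 3 => (MvPolynomial.X i : MvPolynomial (Fin 3) k) ^ 2) ↔
      (ψ ∉ Ideal.span (Set.range fun i : Fin 2 => (MvPolynomial.X i : MvPolynomial (Fin 2) k) ^ 2) ∨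
        φ ∉ Ideal.span (Set.range fun i : Fin 2 => (MvPolynomial.X i : MvPolynomial (Fin 2) k) ^ 2))) := by
  intro k _ _ ψ φ
  rw [← not_and_or]
  refine not_congr ⟨fun hg => ⟨?_, ?_⟩, fun h => ?_⟩
  · -- `g ∈ M₃ → ψ ∈ M₂`: the monomials `X₂ m₀`, `m₀ ∈ supp ψ`, of `g`
    rw [mem_span_X_pow_iff] at hg ⊢
    intro m₀ hm₀
    obtain ⟨i, hi⟩ := hg (Finsupp.single (2 : Fin 3) 1 + Finsupp.mapDomain Fin.castSucc m₀)
      (by rw [mem_support_iff, coeff_X₂_mul_eq]; exact mem_support_iff.mp hm₀)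
    rcases Fin.eq_castSucc_or_eq_last i with ⟨j, rfl⟩ | rfl
    · exact ⟨j, by rwa [single_add_mapDomain_castSucc] at hi⟩
    · exfalso
      change 2 ≤ (Finsupp.single (2 : Fin 3) 1 + Finsupp.mapDomain Fin.castSucc m₀ : Fin 3 →₀ ℕ) 2
        at hi
      rw [single_add_mapDomain_two] at hi
      omega
  · -- `g ∈ M₃ → φ ∈ M₂`: the monomials `m₀ ∈ supp φ` of `g`
    rw [mem_span_X_pow_iff] at hg ⊢
    intro m₀ hm₀
    obtain ⟨i, hi⟩ := hg (Finsupp.mapDomain Fin.castSucc m₀)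
      (by rw [mem_support_iff, coeff_plane_eq]; exact mem_support_iff.mp hm₀)
    rcases Fin.eq_castSucc_or_eq_last i with ⟨j, rfl⟩ | rfl
    · exact ⟨j, by rwa [Finsupp.mapDomain_apply (Fin.castSucc_injective 2)] at hi⟩
    · exfalso
      change 2 ≤ (Finsupp.mapDomain Fin.castSucc m₀ : Fin 3 →₀ ℕ) 2 at hi
      rw [mapDomain_castSucc_two] at hi
      omega
  · -- `ψ, φ ∈ M₂ → g ∈ M₃`, termwise
    obtain ⟨hψ, hφ⟩ := h
    exact Ideal.add_mem _ (Ideal.add_mem _ (Ideal.subset_span ⟨2, rfl⟩)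
      (Ideal.mul_mem_left _ _ (rename_mem_of_mem 2 hψ))) (rename_mem_of_mem 2 hφ)

end Summit.ResolutionOfSingularities.ResolutionOfSingularities.Theorems.FInjectiveMacaulayfication.DoublePointFedderTwo
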